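import Literature.Probability.Percolation.CellQuad
import Literature.Topology.PlaneTopology.ArcLoops
import HarnessLib

/-!
# Quads bounded by four simple arcs; closed Jordan domains off unbounded connected sets

Topic `Probability/Percolation`; plumbing for the sub-quad thickening lemma
(`QuadSubquadThickening.lean`: a crossing arc of a quad avoiding a closed set runs inside a
crossed sub-quad avoiding it), which cuts a band around an arc out of two closed Jordan domains
glued along the arc.  Everything is proved from results of the tree:

* `disjoint_closure_ofLoop_of_not_isBounded` — **the closed Jordan domain bounded by a loop `γ`
  misses every preconnected unbounded set off the curve** (such a set lies in the unbounded
  complementary component; `JordanDomain.mem_ofLoop_carrier_iff`, `PolygonalDomains.lean`);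
* `closure_ofLoop_inter_closure_ofLoop_subset` — **two closed Jordan domains, each reaching an
  unbounded connected set off the other curve, meet only along their boundary curves**;
* `exists_quad_of_four_arcs` — **four simple arcs `A₀ : p₀ → p₁`, …, `A₃ : p₃ → p₀` closing up a
  Jordan curve bound a quad** `Q ∈ 𝒬_ℂ` (Schramm–Smirnov's parametrised quads,
  `QuadCrossingSpace.lean`) with `[Q]` the closed Jordan domain and sides
  `∂₀Q = A₃, ∂₁Q = A₀, ∂₂Q = A₁, ∂₃Q = A₂` (the loop of `exists_loop_of_four_arcs`, `ArcLoops.lean`,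
  the Jordan domain `JordanDomain.ofLoop`, marked at the quarter parameters, read as a quad through
  a square model — Schoenflies — by `CellComplex.exists_quad_of_conformalRectangle`, `CellQuad.lean`).

## References

* O. Schramm, S. Smirnov, *On the scaling limits of planar percolation*, Ann. Probab. 39 (2011),
  §1.3 (quads). [SchrammSmirnov2011]
* Ch. Pommerenke, *Boundary Behaviour of Conformal Maps* (1992), §2.3 Cor. 2.9 (Schoenflies).
  [PommerenkeBBCM1992]
-/

noncomputable section

open Set Metric Bornology
open Literature.Topology.PlaneTopology
open Literature.Probability.RandomPlanarGeometry

namespace Literature.Probability.Percolation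

namespace QuadCrossing

/-! ### Closed Jordan domains and unbounded connected sets off the curve -/

section OfLoop

variable {γ : ℝ → ℂ} (hγ : Continuous γ) (hp : γ.Periodic 1) (hinj : InjOn γ (Ico 0 1))

/-- **The closed Jordan domain bounded by `γ` misses every preconnected unbounded set `W` off the
curve**: `W` lies in one complementary component of the curve, which is then unbounded, whereas
the inside is the bounded component. [folklore] -/
theorem disjoint_closure_ofLoop_of_not_isBounded {W : Set ℂ} (hW : IsPreconnected W)
    (hWb : ¬ IsBounded W) (hWγ : Disjoint W (range γ)) :
    Disjoint W (closure (JordanDomain.ofLoop hγ hp hinj).carrier) := by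
  rw [(JordanDomain.ofLoop hγ hp hinj).closure_eq, JordanDomain.ofLoop_boundary,
    disjoint_union_right]
  refine ⟨Set.disjoint_left.2 fun z hzW hzD => hWb ?_, hWγ⟩
  rw [JordanDomain.mem_ofLoop_carrier_iff] at hzD
  exact hzD.2.subset (hW.subset_connectedComponentIn hzW fun x hx => Set.disjoint_left.1 hWγ hx)

/-- Points of the closed Jordan domain off the curve are inside. [folklore] -/
theorem mem_ofLoop_carrier_of_mem_closure {z : ℂ}
    (hz : z ∈ closure (JordanDomain.ofLoop hγ hp hinj).carrier) (hzγ : z ∉ range γ) :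
    z ∈ (JordanDomain.ofLoop hγ hp hinj).carrier := by
  rw [(JordanDomain.ofLoop hγ hp hinj).closure_eq, JordanDomain.ofLoop_boundary] at hz
  exact hz.resolve_right hzγ

/-- A left half-plane `{re < c}` is unbounded. [folklore] -/
theorem not_isBounded_setOf_re_lt (c : ℝ) : ¬ IsBounded {z : ℂ | z.re < c} := by
  intro h
  obtain ⟨r, hr⟩ := h.subset_closedBall 0
  have hz : ((min c 0 - |r| - 1 : ℝ) : ℂ) ∈ {z : ℂ | z.re < c} := by
    show ((min c 0 - |r| - 1 : ℝ) : ℂ).re < c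
    rw [Complex.ofReal_re]
    linarith [min_le_left c 0, abs_nonneg r]
  have h1 := hr hz
  rw [mem_closedBall, dist_zero_right, Complex.norm_real, Real.norm_eq_abs] at h1
  have h2 : |min c 0 - |r| - 1| = |r| + 1 - min c 0 := by
    rw [abs_of_nonpos (by linarith [min_le_right c 0, abs_nonneg r])]; ring
  rw [h2] at h1
  linarith [min_le_right c 0, le_abs_self r]

/-- A right half-plane `{c < re}` is unbounded. [folklore] -/
theorem not_isBounded_setOf_lt_re (c : ℝ) : ¬ IsBounded {z : ℂ | c < z.re} := by
  intro h
  obtain ⟨r, hr⟩ := h.subset_closedBall 0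
  have hz : ((max c 0 + |r| + 1 : ℝ) : ℂ) ∈ {z : ℂ | c < z.re} := by
    show c < ((max c 0 + |r| + 1 : ℝ) : ℂ).re
    rw [Complex.ofReal_re]
    linarith [le_max_left c 0, abs_nonneg r]
  have h1 := hr hz
  rw [mem_closedBall, dist_zero_right, Complex.norm_real, Real.norm_eq_abs,
    abs_of_nonneg (by linarith [le_max_right c 0, abs_nonneg r])] at h1
  linarith [le_max_right c 0, le_abs_self r]

/-- A lower half-plane `{im < c}` is unbounded. [folklore] -/
theorem not_isBounded_setOf_im_lt (c : ℝ) : ¬ IsBounded {z : ℂ | z.im < c} := by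
  intro h
  obtain ⟨r, hr⟩ := h.subset_closedBall 0
  have hz : ((min c 0 - |r| - 1 : ℝ) : ℂ) * Complex.I ∈ {z : ℂ | z.im < c} := by
    show (((min c 0 - |r| - 1 : ℝ) : ℂ) * Complex.I).im < c
    rw [Complex.im_ofReal_mul, Complex.I_im, mul_one]
    linarith [min_le_left c 0, abs_nonneg r]
  have h1 := hr hz
  rw [mem_closedBall, dist_zero_right, norm_mul, Complex.norm_I, mul_one, Complex.norm_real,
    Real.norm_eq_abs] at h1
  have h2 : |min c 0 - |r| - 1| = |r| + 1 - min c 0 := by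
    rw [abs_of_nonpos (by linarith [min_le_right c 0, abs_nonneg r])]; ring
  rw [h2] at h1
  linarith [min_le_right c 0, le_abs_self r]

/-- An upper half-plane `{c < im}` is unbounded. [folklore] -/
theorem not_isBounded_setOf_lt_im (c : ℝ) : ¬ IsBounded {z : ℂ | c < z.im} := by
  intro h
  obtain ⟨r, hr⟩ := h.subset_closedBall 0
  have hz : ((max c 0 + |r| + 1 : ℝ) : ℂ) * Complex.I ∈ {z : ℂ | c < z.im} := by
    show c < (((max c 0 + |r| + 1 : ℝ) : ℂ) * Complex.I).im
    rw [Complex.im_ofReal_mul, Complex.I_im, mul_one]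
    linarith [le_max_left c 0, abs_nonneg r]
  have h1 := hr hz
  rw [mem_closedBall, dist_zero_right, norm_mul, Complex.norm_I, mul_one, Complex.norm_real,
    Real.norm_eq_abs, abs_of_nonneg (by linarith [le_max_right c 0, abs_nonneg r])] at h1
  linarith [le_max_right c 0, le_abs_self r]

/-- **A closed Jordan domain lies in every closed box containing its boundary curve** (each of
the four complementary open half-planes is a connected unbounded set off the curve). [folklore] -/
theorem closure_ofLoop_subset_reProdIm {x₀ x₁ y₀ y₁ : ℝ}
    (h : range γ ⊆ Icc x₀ x₁ ×ℂ Icc y₀ y₁) :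
    closure (JordanDomain.ofLoop hγ hp hinj).carrier ⊆ Icc x₀ x₁ ×ℂ Icc y₀ y₁ := by
  intro z hz
  have aux : ∀ {W : Set ℂ}, Convex ℝ W → ¬ IsBounded W → (∀ w ∈ range γ, w ∉ W) → z ∉ W :=
    fun hWc hWb hWγ hzW => Set.disjoint_left.1 (disjoint_closure_ofLoop_of_not_isBounded hγ hp
      hinj hWc.isPreconnected hWb (Set.disjoint_left.2 fun w hw hwγ => hWγ w hwγ hw)) hzW hz
  have h1 : ¬ z.re < x₀ := aux (W := {w | w.re < x₀}) (convex_halfSpace_re_lt x₀)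
    (not_isBounded_setOf_re_lt x₀) fun w hw hlt => not_le.2 hlt (h hw).1.1
  have h2 : ¬ x₁ < z.re := aux (W := {w | x₁ < w.re}) (convex_halfSpace_re_gt x₁)
    (not_isBounded_setOf_lt_re x₁) fun w hw hlt => not_le.2 hlt (h hw).1.2
  have h3 : ¬ z.im < y₀ := aux (W := {w | w.im < y₀}) (convex_halfSpace_im_lt y₀)
    (not_isBounded_setOf_im_lt y₀) fun w hw hlt => not_le.2 hlt (h hw).2.1
  have h4 : ¬ y₁ < z.im := aux (W := {w | y₁ < w.im}) (convex_halfSpace_im_gt y₁)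
    (not_isBounded_setOf_lt_im y₁) fun w hw hlt => not_le.2 hlt (h hw).2.2
  exact ⟨⟨not_lt.1 h1, not_lt.1 h2⟩, not_lt.1 h3, not_lt.1 h4⟩

/-- The open Jordan domain lies in the open box when its curve lies in the closed box. [folklore] -/
theorem ofLoop_carrier_subset_reProdIm {x₀ x₁ y₀ y₁ : ℝ}
    (h : range γ ⊆ Icc x₀ x₁ ×ℂ Icc y₀ y₁) :
    (JordanDomain.ofLoop hγ hp hinj).carrier ⊆ Ioo x₀ x₁ ×ℂ Ioo y₀ y₁ := by
  rw [← interior_Icc, ← interior_Icc, ← Complex.interior_reProdIm]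
  exact interior_maximal (subset_closure.trans (closure_ofLoop_subset_reProdIm hγ hp hinj h))
    (JordanDomain.ofLoop hγ hp hinj).isOpen

/-- Every point of the curve is a limit of inside points: a ball around it meets the domain.
[folklore] -/
theorem exists_mem_ofLoop_carrier_dist_lt {z : ℂ} (hz : z ∈ range γ) {ε : ℝ} (hε : 0 < ε) :
    ∃ w ∈ (JordanDomain.ofLoop hγ hp hinj).carrier, dist z w < ε := by
  have hz' : z ∈ closure (JordanDomain.ofLoop hγ hp hinj).carrier := by
    rw [← JordanDomain.frontier_ofLoop_carrier hγ hp hinj] at hz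
    exact frontier_subset_closure hz
  exact Metric.mem_closure_iff.1 hz' ε hε

/-- The curve misses the (open) inside. [folklore] -/
theorem disjoint_range_ofLoop_carrier :
    Disjoint (range γ) (JordanDomain.ofLoop hγ hp hinj).carrier := by
  rw [← JordanDomain.frontier_ofLoop_carrier hγ hp hinj]
  exact Set.disjoint_left.2 fun z hz hzD => by
    have := (JordanDomain.ofLoop hγ hp hinj).isOpen.inter_frontier_eq
    exact (eq_empty_iff_forall_notMem.1 this z) ⟨hzD, hz⟩

variable {γ' : ℝ → ℂ} (hγ' : Continuous γ') (hp' : γ'.Periodic 1) (hinj' : InjOn γ' (Ico 0 1))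

/-- **Two closed Jordan domains meeting only along their curves.**  Let `D`, `D'` be the Jordan
domains bounded by the loops `γ`, `γ'`; suppose each curve misses the other domain, and that some
preconnected unbounded set off `γ` meets `D'` and some preconnected unbounded set off `γ'` meets
`D`.  Then `closure D ∩ closure D' ⊆ range γ ∩ range γ'`: the domain `D'` together with its
unbounded set is a connected unbounded set off `γ`, hence off `closure D`
(`disjoint_closure_ofLoop_of_not_isBounded`), and symmetrically. [folklore] -/
theorem closure_ofLoop_inter_closure_ofLoop_subset
    (h₁ : Disjoint (range γ) (JordanDomain.ofLoop hγ' hp' hinj').carrier)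
    (h₂ : Disjoint (range γ') (JordanDomain.ofLoop hγ hp hinj).carrier)
    {W W' : Set ℂ} (hW : IsPreconnected W) (hWb : ¬ IsBounded W) (hWγ : Disjoint W (range γ))
    (hWD : (W ∩ (JordanDomain.ofLoop hγ' hp' hinj').carrier).Nonempty)
    (hW' : IsPreconnected W') (hWb' : ¬ IsBounded W') (hWγ' : Disjoint W' (range γ'))
    (hWD' : (W' ∩ (JordanDomain.ofLoop hγ hp hinj).carrier).Nonempty) :
    closure (JordanDomain.ofLoop hγ hp hinj).carrier ∩
        closure (JordanDomain.ofLoop hγ' hp' hinj').carrier ⊆ range γ ∩ range γ' := by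
  -- each open domain misses the other closed domain
  have key : ∀ {γ₁ γ₂ : ℝ → ℂ} (hγ₁ : Continuous γ₁) (hp₁ : γ₁.Periodic 1)
      (hinj₁ : InjOn γ₁ (Ico 0 1)) (hγ₂ : Continuous γ₂) (hp₂ : γ₂.Periodic 1)
      (hinj₂ : InjOn γ₂ (Ico 0 1)),
      Disjoint (range γ₁) (JordanDomain.ofLoop hγ₂ hp₂ hinj₂).carrier →
      ∀ {W : Set ℂ}, IsPreconnected W → ¬ IsBounded W → Disjoint W (range γ₁) →
      (W ∩ (JordanDomain.ofLoop hγ₂ hp₂ hinj₂).carrier).Nonempty →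
      Disjoint (JordanDomain.ofLoop hγ₂ hp₂ hinj₂).carrier
        (closure (JordanDomain.ofLoop hγ₁ hp₁ hinj₁).carrier) := by
    intro γ₁ γ₂ hγ₁ hp₁ hinj₁ hγ₂ hp₂ hinj₂ h W hW hWb hWγ hWD
    obtain ⟨w, hwW, hwD⟩ := hWD
    have hU : IsPreconnected (W ∪ (JordanDomain.ofLoop hγ₂ hp₂ hinj₂).carrier) :=
      hW.union w hwW hwD (JordanDomain.ofLoop hγ₂ hp₂ hinj₂).isConnected.isPreconnected
    have hUb : ¬ IsBounded (W ∪ (JordanDomain.ofLoop hγ₂ hp₂ hinj₂).carrier) := fun hb =>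
      hWb (hb.subset subset_union_left)
    have hUγ : Disjoint (W ∪ (JordanDomain.ofLoop hγ₂ hp₂ hinj₂).carrier) (range γ₁) :=
      disjoint_union_left.2 ⟨hWγ, h.symm⟩
    exact (disjoint_closure_ofLoop_of_not_isBounded hγ₁ hp₁ hinj₁ hU hUb hUγ).mono_left
      subset_union_right
  have hD'D := key hγ hp hinj hγ' hp' hinj' h₁ hW hWb hWγ hWD
  have hDD' := key hγ' hp' hinj' hγ hp hinj h₂ hW' hWb' hWγ' hWD'
  rintro z ⟨hz, hz'⟩
  refine ⟨by_contra fun hzγ => ?_, by_contra fun hzγ' => ?_⟩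
  · exact Set.disjoint_left.1 hDD' (mem_ofLoop_carrier_of_mem_closure hγ hp hinj hz hzγ) hz'
  · exact Set.disjoint_left.1 hD'D (mem_ofLoop_carrier_of_mem_closure hγ' hp' hinj' hz' hzγ') hz

end OfLoop

/-! ### The quad bounded by four simple arcs -/

/-- **Four simple arcs closing up a Jordan curve bound a quad.**  Let `A₀ : p₀ → p₁`,
`A₁ : p₁ → p₂`, `A₂ : p₂ → p₃`, `A₃ : p₃ → p₀` be simple arcs, consecutive ones meeting only at the
common end-point and opposite ones disjoint.  Then there are a Jordan loop `γ` with range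
`A₀ ∪ A₁ ∪ A₂ ∪ A₃` and a quad `Q ∈ 𝒬_ℂ` whose carrier is the closed Jordan domain bounded by `γ`
and whose sides are `∂₀Q = A₃`, `∂₁Q = A₀`, `∂₂Q = A₁`, `∂₃Q = A₂` (so that `Q(0,0) = p₀`,
`Q(1,0) = p₁`, `Q(1,1) = p₂`, `Q(0,1) = p₃`).  The loop is `exists_loop_of_four_arcs`; the quad is
the square model (Schoenflies) of the Jordan domain marked at the quarter parameters.
[cite: SchrammSmirnov2011, §1.3 (quads); proof of Lemma 5.1 (square models)] -/
theorem exists_quad_of_four_arcs {A₀ A₁ A₂ A₃ : Set ℂ} {p₀ p₁ p₂ p₃ : ℂ}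
    (h₀ : IsSimpleArc A₀ p₀ p₁) (h₁ : IsSimpleArc A₁ p₁ p₂) (h₂ : IsSimpleArc A₂ p₂ p₃)
    (h₃ : IsSimpleArc A₃ p₃ p₀) (h01 : A₀ ∩ A₁ ⊆ {p₁}) (h12 : A₁ ∩ A₂ ⊆ {p₂})
    (h23 : A₂ ∩ A₃ ⊆ {p₃}) (h30 : A₃ ∩ A₀ ⊆ {p₀}) (h02 : Disjoint A₀ A₂) (h13 : Disjoint A₁ A₃) :
    ∃ (γ : ℝ → ℂ) (hγ : Continuous γ) (hp : γ.Periodic 1) (hinj : InjOn γ (Ico 0 1))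
      (Q : Quad (univ : Set ℂ)), range γ = A₀ ∪ A₁ ∪ A₂ ∪ A₃ ∧
        Q.carrier = closure (JordanDomain.ofLoop hγ hp hinj).carrier ∧
        Q.side 0 = A₃ ∧ Q.side 1 = A₀ ∧ Q.side 2 = A₁ ∧ Q.side 3 = A₂ := by
  obtain ⟨γ, hγ, hp, hinj, hrange, -, -, -, -, hI₀, hI₁, hI₂, hI₃⟩ :=
    exists_loop_of_four_arcs h₀ h₁ h₂ h₃ h01 h12 h23 h30 h02 h13
  -- the Jordan domain of `γ`, marked at the quarter parameters
  let R : ConformalRectangle :=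
    { toJordanDomain := JordanDomain.ofLoop hγ hp hinj
      mark := quarterMarks
      strictMono_mark := strictMono_quarterMarks
      mark_mem := quarterMarks_mem }
  have hb : R.boundary = γ := rfl
  have hm : ∀ i, R.mark i = (i : ℝ) / 4 := fun i => rfl
  have ha0 : R.arc 0 = γ '' Icc 0 (1 / 4) := by
    show R.boundary '' Icc (R.mark 0) (R.nextMark 0) = _
    rw [SquareModel.nextMark_zero, hb, hm, hm]; norm_num
  have ha1 : R.arc 1 = γ '' Icc (1 / 4) (1 / 2) := by
    show R.boundary '' Icc (R.mark 1) (R.nextMark 1) = _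
    rw [SquareModel.nextMark_one, hb, hm, hm]; norm_num
  have ha2 : R.arc 2 = γ '' Icc (1 / 2) (3 / 4) := by
    show R.boundary '' Icc (R.mark 2) (R.nextMark 2) = _
    rw [SquareModel.nextMark_two, hb, hm, hm]; norm_num
  have ha3 : R.arc 3 = γ '' Icc (3 / 4) 1 := by
    show R.boundary '' Icc (R.mark 3) (R.nextMark 3) = _
    rw [SquareModel.nextMark_three, hb, hm, hm]; norm_num
  obtain ⟨Q, hQc, hQs⟩ :=
    CellComplex.exists_quad_of_conformalRectangle (D := (univ : Set ℂ)) R (subset_univ _)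
  refine ⟨γ, hγ, hp, hinj, Q, hrange, hQc, ?_, ?_, ?_, ?_⟩
  · rw [hQs 0, show (0 : Fin 4) + 3 = 3 from rfl, ha3, hI₃]
  · rw [hQs 1, show (1 : Fin 4) + 3 = 0 from rfl, ha0, hI₀]
  · rw [hQs 2, show (2 : Fin 4) + 3 = 1 from rfl, ha1, hI₁]
  · rw [hQs 3, show (3 : Fin 4) + 3 = 2 from rfl, ha2, hI₂]

end QuadCrossing

end Literature.Probability.Percolation
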